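import Literature.NumberTheory.Sieve.Maynard2016CoupledKernel
import Literature.NumberTheory.Sieve.PolymathLcmSumsZeta

/-!
# Maynard (2016), Lemma 6: the coupled Euler factor against the `ζ`-factors ((6.11)–(6.13))

Trunk: AntSieve / parity (Maynard 2016 large-gaps ladder, named fact
`Literature.NumberTheory.Sieve.Maynard2016.Lemma6MainTerm` of `Maynard2016Lemma6Split.lean`).

J. Maynard, *Large gaps between primes*, Ann. of Math. 183 (2016) = arXiv:1408.5110, §6, proof of
Lemma 6, p. 10.  The Euler factor `K_p` of the coupled kernel (the tree's
`LcmEuler.coupledLocalFactorMu m M a b a' b' p`, exponents `a_i = s_i`, `b_i = s'_i` on the `d`-side and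
`a'_j = r_j`, `b'_j = r'_j` on the `e`-side, coupling sets `M p`, the `e`-slots switched off at `p ∣ m`)
is compared with the `ζ`-side factor of (6.12),
`B_p(s,s') B_p(r,r') = ∏_ℓ (1−p^{−1−s_ℓ})(1−p^{−1−s'_ℓ})(1−p^{−1−s_ℓ−s'_ℓ})^{−1} × (same in r)`
(the tree's `LcmEuler.zetaFactor`), and with the extra factor `(1 + ν_p/p)` of (6.13),
`ν_p = #{(j,ℓ) : p ∣ mq(h_ℓ−h_j) − 1}` (and `ν_p = k` at `p ∣ m`, where `ω_{m,q}(p) = k`; in both cases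
`1 + ν_p/p = 1 − (ω_{m,q}(p) − 2k)/p` by `Maynard2016.omegaMQ_add_card_couplingSet`).  PROVED here:
* `LcmEuler.coupledLocalFactorMu_eq` / `…_of_dvd` / `…_of_not_dvd` — the closed form of `K_p` in
  terms of the slots `σ_i(p) = p^{−a_i−b_i} − p^{−a_i} − p^{−b_i}` and Polymath's uncoupled factors
  `LcmEuler.localFactor` ("(6.11)");
* `LcmEuler.norm_coupledLocalFactorMu_sub_zetaFactor_mul_le_of_good` — **(6.12)**: at a good prime
  (`p ∤ m`, `M p = ∅`), `‖K_p − B_p(s,s')B_p(r,r')‖ ≤ C₁(k,k')/p²`;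
* `LcmEuler.norm_coupledLocalFactorMu_sub_le` — **(6.13)**: at any prime,
  `‖K_p − B_p(s,s') B_p(r,r') (1 + ν_p/p)‖ ≤ C₁(k,k')/p² + C₂(k,k') τ log p / p` when all exponents have
  norm `≤ τ` (Maynard's `O_k(p^{−2} + log p √(log x)/(p log y))` with `τ ≍ √(log x)/log y`; no smallness
  of `τ log p` is required);
* `LcmEuler.coupledEps` and `LcmEuler.coupledLocalFactorMu_eq_mul` — `K_p = (1 + η_p) B_p B'_p (1 + ν_p/p)`
  with the bounds `norm_coupledEps_le_of_good`, `norm_coupledEps_le`.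

## References

* J. Maynard, *Large gaps between primes*, Ann. of Math. (2) 183 (2016), 915–933; arXiv:1408.5110,
  §6, proof of Lemma 6, displays (6.11)–(6.13). [Maynard2016LargeGaps]
* D. H. J. Polymath, *Variants of the Selberg sieve, and bounded intervals containing many primes*,
  Res. Math. Sci. 1 (2014), Art. 12; arXiv:1407.4897, proof of Lemma 4.1, (kp-est). [Polymath8b2014]
-/

noncomputable section

open Finset
open scoped BigOperators ArithmeticFunction.Moebius Classical

namespace Literature.NumberTheory.Sieve

namespace LcmEuler

variable {ι κ : Type*} [Fintype ι] [Fintype κ]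

/-! ### The slots and the closed form of `K_p` -/

/-- The slot `σ_i(p) = p^{−a_i} p^{−b_i} − p^{−a_i} − p^{−b_i}` (the `p`-part of
`Σ_{[d_i,d'_i] = p} μ(d_i)μ(d'_i) d_i^{−a_i} d'_i^{−b_i}`). [cite: Maynard2016LargeGaps, §6 display (6.11)] -/
def muSlot {α : Type*} (a b : α → ℂ) (q : ℕ) (i : α) : ℂ :=
  (q : ℂ) ^ (-a i) * (q : ℂ) ^ (-b i) - (q : ℂ) ^ (-a i) - (q : ℂ) ^ (-b i)

omit [Fintype ι] [Fintype κ] in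
/-- At a prime the Möbius slot is `σ_i(p)`. [cite: Maynard2016LargeGaps, §6 display (6.11)] -/
theorem slotTerm_moebiusWeight {α : Type*} (a b : α → ℂ) {q : ℕ} (hq : q.Prime) (i : α) :
    slotTerm (moebiusWeight a) (moebiusWeight b) q i = muSlot a b q i := by
  simp only [slotTerm, moebiusWeight, muSlot, ArithmeticFunction.moebius_apply_prime hq]
  push_cast
  ring

/-- The coupling sum `Σ_{(i,j) ∈ M_p} σ_i(p) σ'_j(p)`. [cite: Maynard2016LargeGaps, §6 display (6.13)] -/
def couplingSum (M : ℕ → Finset (ι × κ)) (a b : ι → ℂ) (a' b' : κ → ℂ) (q : ℕ) : ℂ :=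
  ∑ p ∈ M q, muSlot a b q p.1 * muSlot a' b' q p.2

/-- **Closed form of `K_p`**: `K_p = 1 + (Σ_i σ_i + [p ∤ m](Σ_j σ'_j + Σ_{M_p} σ_i σ'_j))/p`.
[cite: Maynard2016LargeGaps, §6 displays (6.11)–(6.13)] -/
theorem coupledLocalFactorMu_eq (m : ℕ) (M : ℕ → Finset (ι × κ)) (a b : ι → ℂ) (a' b' : κ → ℂ)
    {q : ℕ} (hq : q.Prime) :
    coupledLocalFactorMu m M a b a' b' q =
      1 + ((∑ i, muSlot a b q i) +
        (if q ∣ m then 0 else (∑ j, muSlot a' b' q j) + couplingSum M a b a' b' q)) / q := by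
  unfold coupledLocalFactorMu coupledLocalFactor couplingSum
  simp_rw [slotTerm_moebiusWeight _ _ hq]

/-- Polymath's uncoupled factor with the weight `1/n` is `1 + (Σ_i σ_i)/p`. [cite: Polymath8b2014, Lemma 4.1 (proof, (kp-est))] -/
theorem localFactor_inv_eq (a b : ι → ℂ) (q : ℕ) :
    localFactor (fun n => (n : ℂ)⁻¹) a b q = 1 + (∑ i, muSlot a b q i) / q := by
  unfold localFactor muSlot
  rw [div_eq_inv_mul]

/-- **`p ∣ m`**: the `e`-slots are switched off and `K_p = K_p^{(d)}` is Polymath's uncoupled factor of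
the `d`-side alone. [cite: Maynard2016LargeGaps, §6 display (6.11)] -/
theorem coupledLocalFactorMu_of_dvd (M : ℕ → Finset (ι × κ)) (a b : ι → ℂ) (a' b' : κ → ℂ)
    {m q : ℕ} (hq : q.Prime) (hqm : q ∣ m) :
    coupledLocalFactorMu m M a b a' b' q = localFactor (fun n => (n : ℂ)⁻¹) a b q := by
  rw [coupledLocalFactorMu_eq m M a b a' b' hq, if_pos hqm, add_zero, localFactor_inv_eq]

/-- **`p ∤ m`**: `K_p = K_p^{(d)} + K_p^{(e)} − 1 + (Σ_{M_p} σ_i σ'_j)/p`. [cite: Maynard2016LargeGaps, §6 displays (6.11)–(6.13)] -/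
theorem coupledLocalFactorMu_of_not_dvd (M : ℕ → Finset (ι × κ)) (a b : ι → ℂ) (a' b' : κ → ℂ)
    {m q : ℕ} (hq : q.Prime) (hqm : ¬ q ∣ m) :
    coupledLocalFactorMu m M a b a' b' q =
      localFactor (fun n => (n : ℂ)⁻¹) a b q + localFactor (fun n => (n : ℂ)⁻¹) a' b' q - 1 +
        couplingSum M a b a' b' q / q := by
  rw [coupledLocalFactorMu_eq m M a b a' b' hq, if_neg hqm, localFactor_inv_eq, localFactor_inv_eq]
  ring

/-! ### Bounds for the slots -/

omit [Fintype ι] [Fintype κ] in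
/-- `σ_i(p) + 1 = (1 − p^{−a_i})(1 − p^{−b_i})`. [cite: Maynard2016LargeGaps, §6 display (6.11)] -/
theorem muSlot_add_one {α : Type*} (a b : α → ℂ) (q : ℕ) (i : α) :
    muSlot a b q i + 1 = (1 - (q : ℂ) ^ (-a i)) * (1 - (q : ℂ) ^ (-b i)) := by
  unfold muSlot; ring

omit [Fintype ι] [Fintype κ] in
/-- `|σ_i(p)| ≤ 3` when `Re a_i, Re b_i ≥ 0`. [cite: Maynard2016LargeGaps, §6 display (6.11)] -/
theorem norm_muSlot_le {α : Type*} {a b : α → ℂ} {q : ℕ} (hq : 0 < q) {i : α}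
    (ha : 0 ≤ (a i).re) (hb : 0 ≤ (b i).re) : ‖muSlot a b q i‖ ≤ 3 := by
  have hu := norm_natCast_cpow_neg_le_one hq ha
  have hv := norm_natCast_cpow_neg_le_one hq hb
  unfold muSlot
  calc ‖(q : ℂ) ^ (-a i) * (q : ℂ) ^ (-b i) - (q : ℂ) ^ (-a i) - (q : ℂ) ^ (-b i)‖
      ≤ ‖(q : ℂ) ^ (-a i) * (q : ℂ) ^ (-b i)‖ + ‖(q : ℂ) ^ (-a i)‖ + ‖(q : ℂ) ^ (-b i)‖ := by
        refine (norm_sub_le _ _).trans (add_le_add (norm_sub_le _ _) le_rfl)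
    _ ≤ 1 * 1 + 1 + 1 := by
        rw [norm_mul]
        exact add_le_add (add_le_add (mul_le_mul hu hv (norm_nonneg _) zero_le_one) hu) hv
    _ = 3 := by norm_num

omit [Fintype ι] [Fintype κ] in
/-- **`σ_i(p) = −1 + O(τ log p)`**: `|σ_i(p) + 1| ≤ 4 τ log p` when `|a_i| ≤ τ` and `Re a_i, Re b_i ≥ 0`
(for `τ log p ≤ 1` from `|1 − p^{−a_i}| ≤ 2|a_i| log p`; for `τ log p > 1` trivially, `|σ_i + 1| ≤ 4`).
[cite: Maynard2016LargeGaps, §6 display (6.13)] -/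
theorem norm_muSlot_add_one_le {α : Type*} {a b : α → ℂ} {q : ℕ} (hq : 2 ≤ q) {i : α} {τ : ℝ}
    (ha : ‖a i‖ ≤ τ) (hai : 0 ≤ (a i).re) (hb : 0 ≤ (b i).re) :
    ‖muSlot a b q i + 1‖ ≤ 4 * (τ * Real.log q) := by
  have hlog : 0 ≤ Real.log q := Real.log_nonneg (by exact_mod_cast (by omega : 1 ≤ q))
  have hτ0 : 0 ≤ τ := (norm_nonneg _).trans ha
  by_cases hτ : τ * Real.log q ≤ 1
  · have h1 : ‖1 - (q : ℂ) ^ (-a i)‖ ≤ 2 * (τ * Real.log q) := by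
      have hs : ‖a i‖ * Real.log q ≤ 1 := (mul_le_mul_of_nonneg_right ha hlog).trans hτ
      exact (norm_one_sub_cpow_neg_le hq hs).trans (by nlinarith [norm_nonneg (a i)])
    have h2 : ‖1 - (q : ℂ) ^ (-b i)‖ ≤ 2 := by
      refine (norm_sub_le _ _).trans ?_
      rw [norm_one]
      have := norm_natCast_cpow_neg_le_one (by omega : 0 < q) hb
      linarith
    rw [muSlot_add_one, norm_mul]
    calc ‖1 - (q : ℂ) ^ (-a i)‖ * ‖1 - (q : ℂ) ^ (-b i)‖ ≤ 2 * (τ * Real.log q) * 2 :=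
        mul_le_mul h1 h2 (norm_nonneg _) (by positivity)
      _ = 4 * (τ * Real.log q) := by ring
  · rw [not_le] at hτ
    calc ‖muSlot a b q i + 1‖ ≤ ‖muSlot a b q i‖ + ‖(1 : ℂ)‖ := norm_add_le _ _
      _ ≤ 3 + 1 := add_le_add (norm_muSlot_le (by omega) hai hb) (by rw [norm_one])
      _ ≤ 4 * (τ * Real.log q) := by linarith

omit [Fintype ι] [Fintype κ] in
/-- `|σ_i σ'_j − 1| ≤ 16 τ log p` under the same hypotheses on both slots (no smallness of `τ log p`
needed). [cite: Maynard2016LargeGaps, §6 display (6.13)] -/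
theorem norm_muSlot_mul_muSlot_sub_one_le {α β : Type*} {a b : α → ℂ} {a' b' : β → ℂ} {q : ℕ}
    (hq : 2 ≤ q) {i : α} {j : β} {τ : ℝ} (ha : ‖a i‖ ≤ τ) (ha' : ‖a' j‖ ≤ τ)
    (hai : 0 ≤ (a i).re) (hb : 0 ≤ (b i).re) (haj : 0 ≤ (a' j).re) (hb' : 0 ≤ (b' j).re) :
    ‖muSlot a b q i * muSlot a' b' q j - 1‖ ≤ 16 * (τ * Real.log q) := by
  have h1 := norm_muSlot_add_one_le hq ha hai hb
  have h2 := norm_muSlot_add_one_le hq ha' haj hb'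
  have h3 : ‖muSlot a b q i‖ ≤ 3 := norm_muSlot_le (by omega) hai hb
  have hτ0 : 0 ≤ τ * Real.log q :=
    mul_nonneg ((norm_nonneg _).trans ha) (Real.log_nonneg (by exact_mod_cast (by omega : 1 ≤ q)))
  have heq : muSlot a b q i * muSlot a' b' q j - 1 =
      muSlot a b q i * (muSlot a' b' q j + 1) - (muSlot a b q i + 1) := by ring
  rw [heq]
  calc ‖muSlot a b q i * (muSlot a' b' q j + 1) - (muSlot a b q i + 1)‖
      ≤ ‖muSlot a b q i‖ * ‖muSlot a' b' q j + 1‖ + ‖muSlot a b q i + 1‖ := by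
        rw [← norm_mul]; exact norm_sub_le _ _
    _ ≤ 3 * (4 * (τ * Real.log q)) + 4 * (τ * Real.log q) :=
        add_le_add (mul_le_mul h3 h2 (norm_nonneg _) (by norm_num)) h1
    _ = 16 * (τ * Real.log q) := by ring

/-- `|Σ_i σ_i| ≤ 3k`. [folklore] -/
private theorem norm_sum_muSlot_le {α : Type*} [Fintype α] {a b : α → ℂ} {q : ℕ} (hq : 0 < q)
    (hab : ∀ i, 0 ≤ (a i).re ∧ 0 ≤ (b i).re) : ‖∑ i, muSlot a b q i‖ ≤ 3 * Fintype.card α := by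
  calc ‖∑ i, muSlot a b q i‖ ≤ ∑ i, ‖muSlot a b q i‖ := norm_sum_le _ _
    _ ≤ ∑ _i : α, (3 : ℝ) := Finset.sum_le_sum fun i _ => norm_muSlot_le hq (hab i).1 (hab i).2
    _ = 3 * Fintype.card α := by rw [Finset.sum_const, nsmul_eq_mul, Finset.card_univ]; ring

/-- `|K_p^{(d)}| ≤ 1 + 3k/p ≤ 2` for `p ≥ 3k`. [folklore] -/
private theorem norm_localFactor_inv_le {α : Type*} [Fintype α] {a b : α → ℂ} {q : ℕ} (hq : 0 < q)
    (hqk : 3 * Fintype.card α ≤ q) (hab : ∀ i, 0 ≤ (a i).re ∧ 0 ≤ (b i).re) :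
    ‖localFactor (fun n => (n : ℂ)⁻¹) a b q‖ ≤ 2 := by
  have hq0 : (0 : ℝ) < q := by exact_mod_cast hq
  have hle : (3 * Fintype.card α : ℝ) ≤ q := by exact_mod_cast hqk
  rw [localFactor_inv_eq]
  refine (norm_add_le _ _).trans ?_
  rw [norm_one, norm_div, Complex.norm_natCast]
  have := norm_sum_muSlot_le hq hab
  have h1 : ‖∑ i, muSlot a b q i‖ / (q : ℝ) ≤ 1 := by
    rw [div_le_one hq0]; linarith
  linarith

/-- `|K_p^{(d)} − 1| ≤ 3k/p`. [folklore] -/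
private theorem norm_localFactor_inv_sub_one_le {α : Type*} [Fintype α] {a b : α → ℂ} {q : ℕ}
    (hq : 0 < q) (hab : ∀ i, 0 ≤ (a i).re ∧ 0 ≤ (b i).re) :
    ‖localFactor (fun n => (n : ℂ)⁻¹) a b q - 1‖ ≤ 3 * Fintype.card α / q := by
  have hq0 : (0 : ℝ) < q := by exact_mod_cast hq
  rw [localFactor_inv_eq, add_sub_cancel_left, norm_div, Complex.norm_natCast]
  exact div_le_div_of_nonneg_right (norm_sum_muSlot_le hq hab) hq0.le

/-- `(49k² + 8k)/p² ≤ 2` for `p ≥ 7k`, `p ≥ 2`. [folklore] -/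
private theorem kp_const_div_sq_le_two (k : ℕ) {q : ℕ} (hq : 2 ≤ q) (hqk : 7 * k ≤ q) :
    (49 * (k : ℝ) ^ 2 + 8 * k) / (q : ℝ) ^ 2 ≤ 2 := by
  have hk : (7 * k : ℝ) ≤ q := by exact_mod_cast hqk
  have hq2 : (2 : ℝ) ≤ q := by exact_mod_cast hq
  have hkk : (k : ℝ) ≤ (k : ℝ) ^ 2 := by exact_mod_cast Nat.le_self_pow two_ne_zero k
  rw [div_le_iff₀ (by positivity)]
  have hk0 : (0 : ℝ) ≤ k := by positivity
  nlinarith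

/-- `|B_p| ≤ 4` for `p ≥ 7k` (from `|K_p^{(d)}| ≤ 2` and (kp-est)). [folklore] -/
private theorem norm_zetaFactor_le_four {α : Type*} [Fintype α] {a b : α → ℂ} {q : ℕ} (hq : 2 ≤ q)
    (hqk : 7 * Fintype.card α ≤ q) (hab : ∀ i, 0 ≤ (a i).re ∧ 0 ≤ (b i).re) :
    ‖zetaFactor a b q‖ ≤ 4 := by
  have hL := norm_localFactor_inv_le (by omega : 0 < q) (by omega) hab
  have hD := norm_localFactor_inv_sub_zetaFactor_le hab hq hqk
  have hsmall := kp_const_div_sq_le_two (Fintype.card α) hq hqk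
  have h' : ‖zetaFactor a b q‖ ≤ ‖localFactor (fun n => (n : ℂ)⁻¹) a b q‖ +
      ‖localFactor (fun n => (n : ℂ)⁻¹) a b q - zetaFactor a b q‖ := by
    have := norm_sub_le (localFactor (fun n => (n : ℂ)⁻¹) a b q)
      (localFactor (fun n => (n : ℂ)⁻¹) a b q - zetaFactor a b q)
    rwa [sub_sub_cancel] at this
  linarith

/-! ### (6.12): good primes -/

/-- At a good prime (`p ∤ m`, `M_p = ∅`): `K_p = K_p^{(d)} K_p^{(e)} − (Σ_i σ_i)(Σ_j σ'_j)/p²`.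
[cite: Maynard2016LargeGaps, §6 display (6.12)] -/
theorem coupledLocalFactorMu_of_good (M : ℕ → Finset (ι × κ)) (a b : ι → ℂ) (a' b' : κ → ℂ)
    {m q : ℕ} (hq : q.Prime) (hqm : ¬ q ∣ m) (hM : M q = ∅) :
    coupledLocalFactorMu m M a b a' b' q =
      localFactor (fun n => (n : ℂ)⁻¹) a b q * localFactor (fun n => (n : ℂ)⁻¹) a' b' q -
        (∑ i, muSlot a b q i) * (∑ j, muSlot a' b' q j) / (q : ℂ) ^ 2 := by
  rw [coupledLocalFactorMu_of_not_dvd M a b a' b' hq hqm, couplingSum, hM, Finset.sum_empty,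
    zero_div, add_zero, localFactor_inv_eq, localFactor_inv_eq]
  have hq0 : (q : ℂ) ≠ 0 := by exact_mod_cast hq.ne_zero
  field_simp
  ring

/-- The constant `C₁(k,k') = 2(49k²+8k) + 4(49k'²+8k') + 9kk'` of (6.12). [cite: Maynard2016LargeGaps, §6 display (6.12)] -/
def goodConst (k k' : ℕ) : ℝ :=
  2 * (49 * (k : ℝ) ^ 2 + 8 * k) + 4 * (49 * (k' : ℝ) ^ 2 + 8 * k') + 9 * k * k'

omit [Fintype ι] [Fintype κ] in
/-- `C₁ ≥ 0`. [cite: Maynard2016LargeGaps, §6 display (6.12)] -/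
theorem goodConst_nonneg (k k' : ℕ) : 0 ≤ goodConst k k' := by unfold goodConst; positivity

/-- `‖K^{(d)} K^{(e)} − B B'‖ ≤ (2(49k²+8k) + 4(49k'²+8k'))/p²`. [folklore] -/
private theorem norm_LL_sub_BB_le {a b : ι → ℂ} {a' b' : κ → ℂ}
    (hab : ∀ i, 0 ≤ (a i).re ∧ 0 ≤ (b i).re) (hab' : ∀ j, 0 ≤ (a' j).re ∧ 0 ≤ (b' j).re) {q : ℕ}
    (hq : 2 ≤ q) (hqk : 7 * Fintype.card ι ≤ q) (hqk' : 7 * Fintype.card κ ≤ q) :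
    ‖localFactor (fun n => (n : ℂ)⁻¹) a b q * localFactor (fun n => (n : ℂ)⁻¹) a' b' q -
        zetaFactor a b q * zetaFactor a' b' q‖ ≤
      (2 * (49 * (Fintype.card ι : ℝ) ^ 2 + 8 * Fintype.card ι) +
        4 * (49 * (Fintype.card κ : ℝ) ^ 2 + 8 * Fintype.card κ)) / (q : ℝ) ^ 2 := by
  set L := localFactor (fun n => (n : ℂ)⁻¹) a b q
  set L' := localFactor (fun n => (n : ℂ)⁻¹) a' b' q
  set B := zetaFactor a b q
  set B' := zetaFactor a' b' q
  have h1 : ‖L - B‖ ≤ _ := norm_localFactor_inv_sub_zetaFactor_le hab hq hqk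
  have h2 : ‖L' - B'‖ ≤ _ := norm_localFactor_inv_sub_zetaFactor_le hab' hq hqk'
  have h3 : ‖L'‖ ≤ 2 := norm_localFactor_inv_le (by omega) (by omega) hab'
  have h4 : ‖B‖ ≤ 4 := norm_zetaFactor_le_four hq hqk hab
  have heq : L * L' - B * B' = (L - B) * L' + B * (L' - B') := by ring
  rw [heq]
  have hq0 : (0 : ℝ) < (q : ℝ) ^ 2 := by positivity
  calc ‖(L - B) * L' + B * (L' - B')‖ ≤ ‖L - B‖ * ‖L'‖ + ‖B‖ * ‖L' - B'‖ := by
        refine (norm_add_le _ _).trans (add_le_add (norm_mul_le _ _) (norm_mul_le _ _))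
    _ ≤ (49 * (Fintype.card ι : ℝ) ^ 2 + 8 * Fintype.card ι) / (q : ℝ) ^ 2 * 2 +
          4 * ((49 * (Fintype.card κ : ℝ) ^ 2 + 8 * Fintype.card κ) / (q : ℝ) ^ 2) :=
        add_le_add (mul_le_mul h1 h3 (norm_nonneg _) (by positivity))
          (mul_le_mul h4 h2 (norm_nonneg _) (by norm_num))
    _ = _ := by ring

/-- **(6.12)**: at a good prime `p ≥ 7k, 7k'` (`p ∤ m`, `M_p = ∅`),
`‖K_p − B_p(s,s') B_p(r,r')‖ ≤ C₁(k,k')/p²`. [cite: Maynard2016LargeGaps, §6 display (6.12)] -/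
theorem norm_coupledLocalFactorMu_sub_zetaFactor_mul_le_of_good {m : ℕ} {M : ℕ → Finset (ι × κ)}
    {a b : ι → ℂ} {a' b' : κ → ℂ} (hab : ∀ i, 0 ≤ (a i).re ∧ 0 ≤ (b i).re)
    (hab' : ∀ j, 0 ≤ (a' j).re ∧ 0 ≤ (b' j).re) {q : ℕ} (hq : q.Prime)
    (hqk : 7 * Fintype.card ι ≤ q) (hqk' : 7 * Fintype.card κ ≤ q) (hqm : ¬ q ∣ m) (hM : M q = ∅) :
    ‖coupledLocalFactorMu m M a b a' b' q - zetaFactor a b q * zetaFactor a' b' q‖ ≤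
      goodConst (Fintype.card ι) (Fintype.card κ) / (q : ℝ) ^ 2 := by
  have hq2 := hq.two_le
  have hq0 : (0 : ℝ) < q := by exact_mod_cast hq.pos
  rw [coupledLocalFactorMu_of_good M a b a' b' hq hqm hM]
  set L := localFactor (fun n => (n : ℂ)⁻¹) a b q
  set L' := localFactor (fun n => (n : ℂ)⁻¹) a' b' q
  set B := zetaFactor a b q
  set B' := zetaFactor a' b' q
  set S := ∑ i, muSlot a b q i
  set S' := ∑ j, muSlot a' b' q j
  have hS : ‖S‖ ≤ 3 * Fintype.card ι := norm_sum_muSlot_le hq.pos hab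
  have hS' : ‖S'‖ ≤ 3 * Fintype.card κ := norm_sum_muSlot_le hq.pos hab'
  have hSS : ‖S * S' / (q : ℂ) ^ 2‖ ≤ 9 * Fintype.card ι * Fintype.card κ / (q : ℝ) ^ 2 := by
    rw [norm_div, norm_mul, norm_pow, Complex.norm_natCast]
    refine div_le_div_of_nonneg_right ?_ (by positivity)
    calc ‖S‖ * ‖S'‖ ≤ 3 * Fintype.card ι * (3 * Fintype.card κ) :=
        mul_le_mul hS hS' (norm_nonneg _) (by positivity)
      _ = _ := by ring
  have hLL := norm_LL_sub_BB_le hab hab' hq2 hqk hqk'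
  calc ‖L * L' - S * S' / (q : ℂ) ^ 2 - B * B'‖ = ‖(L * L' - B * B') - S * S' / (q : ℂ) ^ 2‖ := by
        ring_nf
    _ ≤ ‖L * L' - B * B'‖ + ‖S * S' / (q : ℂ) ^ 2‖ := norm_sub_le _ _
    _ ≤ _ := by
        refine (add_le_add hLL hSS).trans (le_of_eq ?_)
        unfold goodConst
        ring

/-! ### (6.13): all primes, with the factor `1 + ν_p/p` -/

/-- `ν_p`: the number of coupled pairs `#M_p` at `p ∤ m`, and `k'` (the number of `e`-slots switched off)
at `p ∣ m`; in both cases `1 + ν_p/p = 1 − (ω_{m,q}(p) − 2k)/p` for `w < p ≤ y`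
(`Maynard2016.omegaMQ_add_card_couplingSet`). [cite: Maynard2016LargeGaps, §6 display (6.13)] -/
def coupledNu (m : ℕ) (M : ℕ → Finset (ι × κ)) (q : ℕ) : ℕ :=
  if q ∣ m then Fintype.card κ else (M q).card

/-- The constant `C₂(k,k')` of the `p^{−2}`-term in (6.13). [cite: Maynard2016LargeGaps, §6 display (6.13)] -/
def badConst (k k' : ℕ) : ℝ :=
  goodConst k k' + 12 * (k' : ℝ) ^ 2 + 8 * (49 * (k' : ℝ) ^ 2 + 8 * k') +
    k * k' * (6 * k + 3 * k' + 2 * (49 * (k : ℝ) ^ 2 + 8 * k) + 4 * (49 * (k' : ℝ) ^ 2 + 8 * k'))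

omit [Fintype ι] [Fintype κ] in
/-- `C₂ ≥ 0`. [cite: Maynard2016LargeGaps, §6 display (6.13)] -/
theorem badConst_nonneg (k k' : ℕ) : 0 ≤ badConst k k' := by
  unfold badConst
  have := goodConst_nonneg k k'
  positivity

/-- `|Σ_j (σ'_j + 1)| ≤ 4k' τ log p`. [folklore] -/
private theorem norm_sum_muSlot_add_card_le {α : Type*} [Fintype α] {a b : α → ℂ} {q : ℕ} (hq : 2 ≤ q)
    {τ : ℝ} (ha : ∀ i, ‖a i‖ ≤ τ) (hab : ∀ i, 0 ≤ (a i).re ∧ 0 ≤ (b i).re) :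
    ‖(∑ i, muSlot a b q i) + Fintype.card α‖ ≤ 4 * Fintype.card α * (τ * Real.log q) := by
  have heq : (∑ i, muSlot a b q i) + (Fintype.card α : ℂ) = ∑ i, (muSlot a b q i + 1) := by
    rw [Finset.sum_add_distrib, Finset.sum_const, nsmul_eq_mul, mul_one, Finset.card_univ]
  rw [heq]
  calc ‖∑ i, (muSlot a b q i + 1)‖ ≤ ∑ i, ‖muSlot a b q i + 1‖ := norm_sum_le _ _
    _ ≤ ∑ _i : α, 4 * (τ * Real.log q) :=
        Finset.sum_le_sum fun i _ => norm_muSlot_add_one_le hq (ha i) (hab i).1 (hab i).2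
    _ = _ := by rw [Finset.sum_const, nsmul_eq_mul, Finset.card_univ]; ring

/-- `|Σ_{M_p} (σ_i σ'_j − 1)| ≤ 16 k k' τ log p` (`#M_p ≤ k k'`). [folklore] -/
private theorem norm_couplingSum_sub_card_le {M : ℕ → Finset (ι × κ)} {a b : ι → ℂ} {a' b' : κ → ℂ}
    {q : ℕ} (hq : 2 ≤ q) {τ : ℝ} (ha : ∀ i, ‖a i‖ ≤ τ) (ha' : ∀ j, ‖a' j‖ ≤ τ)
    (hab : ∀ i, 0 ≤ (a i).re ∧ 0 ≤ (b i).re)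
    (hab' : ∀ j, 0 ≤ (a' j).re ∧ 0 ≤ (b' j).re) (hτ0 : 0 ≤ τ) :
    ‖couplingSum M a b a' b' q - (M q).card‖ ≤
      16 * Fintype.card ι * Fintype.card κ * (τ * Real.log q) := by
  have hτL : 0 ≤ τ * Real.log q :=
    mul_nonneg hτ0 (Real.log_nonneg (by exact_mod_cast (by omega : 1 ≤ q)))
  have heq : couplingSum M a b a' b' q - ((M q).card : ℂ) =
      ∑ p ∈ M q, (muSlot a b q p.1 * muSlot a' b' q p.2 - 1) := by
    rw [Finset.sum_sub_distrib, Finset.sum_const, nsmul_eq_mul, mul_one, couplingSum]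
  rw [heq]
  have hcard : ((M q).card : ℝ) ≤ Fintype.card ι * Fintype.card κ := by
    have := Finset.card_le_univ (M q)
    rw [Fintype.card_prod] at this
    exact_mod_cast this
  calc ‖∑ p ∈ M q, (muSlot a b q p.1 * muSlot a' b' q p.2 - 1)‖
      ≤ ∑ p ∈ M q, ‖muSlot a b q p.1 * muSlot a' b' q p.2 - 1‖ := norm_sum_le _ _
    _ ≤ ∑ _p ∈ M q, 16 * (τ * Real.log q) := Finset.sum_le_sum fun p _ =>
        norm_muSlot_mul_muSlot_sub_one_le hq (ha p.1) (ha' p.2) (hab p.1).1 (hab p.1).2 (hab' p.2).1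
          (hab' p.2).2
    _ = (M q).card * (16 * (τ * Real.log q)) := by rw [Finset.sum_const, nsmul_eq_mul]
    _ ≤ (Fintype.card ι * Fintype.card κ : ℝ) * (16 * (τ * Real.log q)) :=
        mul_le_mul_of_nonneg_right hcard (by positivity)
    _ = _ := by ring

/-- (6.13), case `p ∣ m`. [cite: Maynard2016LargeGaps, §6 display (6.13)] -/
private theorem norm_sub_le_of_dvd {m : ℕ} {M : ℕ → Finset (ι × κ)} {a b : ι → ℂ} {a' b' : κ → ℂ}
    (hab : ∀ i, 0 ≤ (a i).re ∧ 0 ≤ (b i).re) (hab' : ∀ j, 0 ≤ (a' j).re ∧ 0 ≤ (b' j).re) {q : ℕ}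
    (hq : q.Prime) (hqk : 7 * Fintype.card ι ≤ q) (hqk' : 7 * Fintype.card κ ≤ q) {τ : ℝ}
    (hτ0 : 0 ≤ τ) (ha' : ∀ j, ‖a' j‖ ≤ τ) (hqm : q ∣ m) :
    ‖coupledLocalFactorMu m M a b a' b' q -
        zetaFactor a b q * zetaFactor a' b' q * (1 + (Fintype.card κ : ℂ) / q)‖ ≤
      ((49 * (Fintype.card ι : ℝ) ^ 2 + 8 * Fintype.card ι) + 12 * (Fintype.card κ : ℝ) ^ 2 +
          8 * (49 * (Fintype.card κ : ℝ) ^ 2 + 8 * Fintype.card κ)) / (q : ℝ) ^ 2 +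
        16 * Fintype.card κ * (τ * Real.log q) / q := by
  have hq2 := hq.two_le
  have hq0 : (0 : ℝ) < q := by exact_mod_cast hq.pos
  have hqC : (q : ℂ) ≠ 0 := by exact_mod_cast hq.ne_zero
  rw [coupledLocalFactorMu_of_dvd M a b a' b' hq hqm]
  set L := localFactor (fun n => (n : ℂ)⁻¹) a b q
  set B := zetaFactor a b q
  set B' := zetaFactor a' b' q
  set S' := ∑ j, muSlot a' b' q j
  set k' := Fintype.card κ
  have hL' : localFactor (fun n => (n : ℂ)⁻¹) a' b' q = 1 + S' / q := localFactor_inv_eq a' b' q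
  have h1 : ‖L - B‖ ≤ _ := norm_localFactor_inv_sub_zetaFactor_le hab hq2 hqk
  have h2 : ‖localFactor (fun n => (n : ℂ)⁻¹) a' b' q - B'‖ ≤ _ :=
    norm_localFactor_inv_sub_zetaFactor_le hab' hq2 hqk'
  rw [hL'] at h2
  have h4 : ‖B‖ ≤ 4 := norm_zetaFactor_le_four hq2 hqk hab
  have hS' : ‖S'‖ ≤ 3 * k' := norm_sum_muSlot_le hq.pos hab'
  have hR' : ‖S' + k'‖ ≤ 4 * k' * (τ * Real.log q) :=
    norm_sum_muSlot_add_card_le hq2 ha' hab'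
  have hk'q : (k' : ℝ) ≤ q := by exact_mod_cast (by omega : k' ≤ q)
  have hone : ‖(1 : ℂ) + (k' : ℂ) / q‖ ≤ 2 := by
    have : (1 : ℂ) + (k' : ℂ) / q = ((1 + (k' : ℝ) / q : ℝ) : ℂ) := by push_cast; ring
    rw [this, Complex.norm_real, Real.norm_eq_abs, abs_of_nonneg (by positivity)]
    have : (k' : ℝ) / q ≤ 1 := by rw [div_le_one hq0]; exact hk'q
    linarith
  have hτL : 0 ≤ τ * Real.log q :=
    mul_nonneg hτ0 (Real.log_nonneg (by exact_mod_cast (by omega : 1 ≤ q)))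
  -- the decomposition
  have heq : L - B * B' * (1 + (k' : ℂ) / q) =
      (L - B) + B * ((-(S' + k') / q - S' * k' / (q : ℂ) ^ 2) +
        (1 + S' / q - B') * (1 + (k' : ℂ) / q)) := by
    field_simp
    ring
  rw [heq]
  have hI1 : ‖-(S' + (k' : ℂ)) / q‖ ≤ 4 * k' * (τ * Real.log q) / q := by
    rw [norm_div, norm_neg, Complex.norm_natCast]
    exact div_le_div_of_nonneg_right hR' hq0.le
  have hI2 : ‖S' * (k' : ℂ) / (q : ℂ) ^ 2‖ ≤ 3 * k' * k' / (q : ℝ) ^ 2 := by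
    rw [norm_div, norm_mul, norm_pow, Complex.norm_natCast, Complex.norm_natCast]
    exact div_le_div_of_nonneg_right (mul_le_mul_of_nonneg_right hS' (by positivity)) (by positivity)
  have hI3 : ‖(1 + S' / q - B') * (1 + (k' : ℂ) / q)‖ ≤
      (49 * (k' : ℝ) ^ 2 + 8 * k') / (q : ℝ) ^ 2 * 2 := by
    rw [norm_mul]; exact mul_le_mul h2 hone (norm_nonneg _) (by positivity)
  have hinner : ‖(-(S' + k') / q - S' * k' / (q : ℂ) ^ 2) +
      (1 + S' / q - B') * (1 + (k' : ℂ) / q)‖ ≤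
      4 * k' * (τ * Real.log q) / q + 3 * k' * k' / (q : ℝ) ^ 2 +
        (49 * (k' : ℝ) ^ 2 + 8 * k') / (q : ℝ) ^ 2 * 2 := by
    refine (norm_add_le _ _).trans (add_le_add ((norm_sub_le _ _).trans (add_le_add hI1 hI2)) hI3)
  calc ‖(L - B) + B * ((-(S' + k') / q - S' * k' / (q : ℂ) ^ 2) +
        (1 + S' / q - B') * (1 + (k' : ℂ) / q))‖
      ≤ ‖L - B‖ + ‖B‖ * ‖(-(S' + k') / q - S' * k' / (q : ℂ) ^ 2) +
        (1 + S' / q - B') * (1 + (k' : ℂ) / q)‖ :=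
        (norm_add_le _ _).trans (add_le_add le_rfl (norm_mul_le _ _))
    _ ≤ (49 * (Fintype.card ι : ℝ) ^ 2 + 8 * Fintype.card ι) / (q : ℝ) ^ 2 +
        4 * (4 * k' * (τ * Real.log q) / q + 3 * k' * k' / (q : ℝ) ^ 2 +
          (49 * (k' : ℝ) ^ 2 + 8 * k') / (q : ℝ) ^ 2 * 2) :=
        add_le_add h1 (mul_le_mul h4 hinner (norm_nonneg _) (by norm_num))
    _ = _ := by ring

/-- (6.13), case `p ∤ m`. [cite: Maynard2016LargeGaps, §6 display (6.13)] -/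
private theorem norm_sub_le_of_not_dvd {m : ℕ} {M : ℕ → Finset (ι × κ)} {a b : ι → ℂ}
    {a' b' : κ → ℂ} (hab : ∀ i, 0 ≤ (a i).re ∧ 0 ≤ (b i).re)
    (hab' : ∀ j, 0 ≤ (a' j).re ∧ 0 ≤ (b' j).re) {q : ℕ} (hq : q.Prime)
    (hqk : 7 * Fintype.card ι ≤ q) (hqk' : 7 * Fintype.card κ ≤ q) {τ : ℝ} (hτ0 : 0 ≤ τ)
    (ha : ∀ i, ‖a i‖ ≤ τ) (ha' : ∀ j, ‖a' j‖ ≤ τ) (hqm : ¬ q ∣ m) :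
    ‖coupledLocalFactorMu m M a b a' b' q -
        zetaFactor a b q * zetaFactor a' b' q * (1 + ((M q).card : ℂ) / q)‖ ≤
      (goodConst (Fintype.card ι) (Fintype.card κ) +
          Fintype.card ι * Fintype.card κ * (6 * Fintype.card ι + 3 * Fintype.card κ +
            2 * (49 * (Fintype.card ι : ℝ) ^ 2 + 8 * Fintype.card ι) +
            4 * (49 * (Fintype.card κ : ℝ) ^ 2 + 8 * Fintype.card κ))) / (q : ℝ) ^ 2 +
        16 * Fintype.card ι * Fintype.card κ * (τ * Real.log q) / q := by
  have hq2 := hq.two_le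
  have hq0 : (0 : ℝ) < q := by exact_mod_cast hq.pos
  have hq1 : (1 : ℝ) ≤ q := by exact_mod_cast hq.one_lt.le
  have hqC : (q : ℂ) ≠ 0 := by exact_mod_cast hq.ne_zero
  rw [coupledLocalFactorMu_of_not_dvd M a b a' b' hq hqm]
  set L := localFactor (fun n => (n : ℂ)⁻¹) a b q
  set L' := localFactor (fun n => (n : ℂ)⁻¹) a' b' q
  set B := zetaFactor a b q
  set B' := zetaFactor a' b' q
  set SM := couplingSum M a b a' b' q
  set k := Fintype.card ι
  set k' := Fintype.card κ
  set n := (M q).card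
  set cK : ℝ := 49 * (k : ℝ) ^ 2 + 8 * k
  set cK' : ℝ := 49 * (k' : ℝ) ^ 2 + 8 * k'
  have hLL : ‖L * L' - B * B'‖ ≤ (2 * cK + 4 * cK') / (q : ℝ) ^ 2 := norm_LL_sub_BB_le hab hab' hq2 hqk hqk'
  have hL1 : ‖L - 1‖ ≤ 3 * k / q := norm_localFactor_inv_sub_one_le hq.pos hab
  have hL1' : ‖L' - 1‖ ≤ 3 * k' / q := norm_localFactor_inv_sub_one_le hq.pos hab'
  have hL' : ‖L'‖ ≤ 2 := norm_localFactor_inv_le hq.pos (by omega) hab'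
  have hSM : ‖SM - n‖ ≤ 16 * k * k' * (τ * Real.log q) :=
    norm_couplingSum_sub_card_le hq2 ha ha' hab hab' hτ0
  have hn : (n : ℝ) ≤ k * k' := by
    have := Finset.card_le_univ (M q)
    rw [Fintype.card_prod] at this
    exact_mod_cast this
  have hτL : 0 ≤ τ * Real.log q :=
    mul_nonneg hτ0 (Real.log_nonneg (by exact_mod_cast (by omega : 1 ≤ q)))
  -- `‖1 − B B'‖ ≤ (6k + 3k' + 2c_k + 4c_k')/q`
  have h1BB : ‖1 - B * B'‖ ≤ (6 * k + 3 * k' + 2 * cK + 4 * cK') / q := by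
    have heq : (1 : ℂ) - B * B' = ((1 - L) * L' + (1 - L')) + (L * L' - B * B') := by ring
    rw [heq]
    have hA : ‖(1 - L) * L' + (1 - L')‖ ≤ 3 * k / q * 2 + 3 * k' / q := by
      refine (norm_add_le _ _).trans (add_le_add ?_ ?_)
      · rw [norm_mul, norm_sub_rev]; exact mul_le_mul hL1 hL' (norm_nonneg _) (by positivity)
      · rw [norm_sub_rev]; exact hL1'
    have hB : (2 * cK + 4 * cK') / (q : ℝ) ^ 2 ≤ (2 * cK + 4 * cK') / q := by
      rw [div_le_div_iff₀ (by positivity) hq0]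
      have : (0 : ℝ) ≤ 2 * cK + 4 * cK' := by positivity
      nlinarith [mul_nonneg (mul_nonneg this hq0.le) (sub_nonneg.2 hq1)]
    calc ‖(1 - L) * L' + (1 - L') + (L * L' - B * B')‖
        ≤ (3 * k / q * 2 + 3 * k' / q) + (2 * cK + 4 * cK') / q :=
          (norm_add_le _ _).trans (add_le_add hA (hLL.trans hB))
      _ = _ := by ring
  -- the decomposition
  have heq : L + L' - 1 + SM / q - B * B' * (1 + (n : ℂ) / q) =
      ((L * L' - B * B') - (L - 1) * (L' - 1)) + ((SM - n) + n * (1 - B * B')) / q := by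
    field_simp
    ring
  rw [heq]
  have hI1 : ‖(L - 1) * (L' - 1)‖ ≤ 3 * k / q * (3 * k' / q) := by
    rw [norm_mul]; exact mul_le_mul hL1 hL1' (norm_nonneg _) (by positivity)
  have hI2 : ‖(n : ℂ) * (1 - B * B')‖ ≤ k * k' * ((6 * k + 3 * k' + 2 * cK + 4 * cK') / q) := by
    rw [norm_mul, Complex.norm_natCast]; exact mul_le_mul hn h1BB (norm_nonneg _) (by positivity)
  have hI3 : ‖((SM - n) + n * (1 - B * B')) / (q : ℂ)‖ ≤
      (16 * k * k' * (τ * Real.log q) + k * k' * ((6 * k + 3 * k' + 2 * cK + 4 * cK') / q)) / q := by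
    rw [norm_div, Complex.norm_natCast]
    exact div_le_div_of_nonneg_right ((norm_add_le _ _).trans (add_le_add hSM hI2)) hq0.le
  calc ‖(L * L' - B * B') - (L - 1) * (L' - 1) + ((SM - n) + n * (1 - B * B')) / (q : ℂ)‖
      ≤ (‖L * L' - B * B'‖ + ‖(L - 1) * (L' - 1)‖) + ‖((SM - n) + n * (1 - B * B')) / (q : ℂ)‖ :=
        (norm_add_le _ _).trans (add_le_add (norm_sub_le _ _) le_rfl)
    _ ≤ ((2 * cK + 4 * cK') / (q : ℝ) ^ 2 + 3 * k / q * (3 * k' / q)) +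
        (16 * k * k' * (τ * Real.log q) + k * k' * ((6 * k + 3 * k' + 2 * cK + 4 * cK') / q)) / q :=
        add_le_add (add_le_add hLL hI1) hI3
    _ = _ := by
        unfold goodConst
        field_simp
        ring

/-- **(6.13)**: at any prime `p ≥ 7k, 7k'`, with all exponents of real part `≥ 0` and
`|s_i|, |r_j| ≤ τ` (no smallness of `τ log p` is needed):
`‖K_p − B_p(s,s') B_p(r,r') (1 + ν_p/p)‖ ≤ C₂(k,k')/p² + 16(k' + kk') τ log p / p`.
[cite: Maynard2016LargeGaps, §6 display (6.13)] -/
theorem norm_coupledLocalFactorMu_sub_le {m : ℕ} {M : ℕ → Finset (ι × κ)} {a b : ι → ℂ}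
    {a' b' : κ → ℂ} (hab : ∀ i, 0 ≤ (a i).re ∧ 0 ≤ (b i).re)
    (hab' : ∀ j, 0 ≤ (a' j).re ∧ 0 ≤ (b' j).re) {q : ℕ} (hq : q.Prime)
    (hqk : 7 * Fintype.card ι ≤ q) (hqk' : 7 * Fintype.card κ ≤ q) {τ : ℝ} (hτ0 : 0 ≤ τ)
    (ha : ∀ i, ‖a i‖ ≤ τ) (ha' : ∀ j, ‖a' j‖ ≤ τ) :
    ‖coupledLocalFactorMu m M a b a' b' q -
        zetaFactor a b q * zetaFactor a' b' q * (1 + (coupledNu m M q : ℂ) / q)‖ ≤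
      badConst (Fintype.card ι) (Fintype.card κ) / (q : ℝ) ^ 2 +
        16 * (Fintype.card κ + Fintype.card ι * Fintype.card κ) * (τ * Real.log q) / q := by
  have hq0 : (0 : ℝ) < q := by exact_mod_cast hq.pos
  have hτL : 0 ≤ τ * Real.log q :=
    mul_nonneg hτ0 (Real.log_nonneg (by exact_mod_cast hq.one_lt.le))
  have hG := goodConst_nonneg (Fintype.card ι) (Fintype.card κ)
  have hk : (0 : ℝ) ≤ Fintype.card ι := by positivity
  have hk' : (0 : ℝ) ≤ Fintype.card κ := by positivity
  unfold coupledNu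
  by_cases hqm : q ∣ m
  · rw [if_pos hqm]
    refine (norm_sub_le_of_dvd hab hab' hq hqk hqk' hτ0 ha' hqm).trans (add_le_add ?_ ?_)
    · refine div_le_div_of_nonneg_right ?_ (by positivity)
      unfold badConst goodConst
      nlinarith [mul_nonneg hk hk', sq_nonneg (Fintype.card ι : ℝ), sq_nonneg (Fintype.card κ : ℝ)]
    · refine div_le_div_of_nonneg_right ?_ hq0.le
      nlinarith [mul_nonneg hk hk']
  · rw [if_neg hqm]
    refine (norm_sub_le_of_not_dvd hab hab' hq hqk hqk' hτ0 ha ha' hqm).trans (add_le_add ?_ ?_)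
    · refine div_le_div_of_nonneg_right ?_ (by positivity)
      unfold badConst
      nlinarith [mul_nonneg hk hk', sq_nonneg (Fintype.card κ : ℝ)]
    · refine div_le_div_of_nonneg_right ?_ hq0.le
      nlinarith [mul_nonneg hk hk']

/-! ### The relative error `η_p` -/

/-- **`η_p`**, defined by `K_p = (1 + η_p) B_p(s,s') B_p(r,r') (1 + ν_p/p)`.
[cite: Maynard2016LargeGaps, §6 display (6.13)] -/
def coupledEps (m : ℕ) (M : ℕ → Finset (ι × κ)) (a b : ι → ℂ) (a' b' : κ → ℂ) (q : ℕ) : ℂ :=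
  coupledLocalFactorMu m M a b a' b' q /
      (zetaFactor a b q * zetaFactor a' b' q * (1 + (coupledNu m M q : ℂ) / q)) - 1

omit [Fintype ι] in
/-- `1 + ν_p/p` is a real number `≥ 1`. [cite: Maynard2016LargeGaps, §6 display (6.13)] -/
theorem one_le_norm_one_add_coupledNu_div (m : ℕ) (M : ℕ → Finset (ι × κ)) (q : ℕ) :
    1 ≤ ‖(1 : ℂ) + (coupledNu m M q : ℂ) / q‖ := by
  have h : (1 : ℂ) + (coupledNu m M q : ℂ) / q = ((1 + (coupledNu m M q : ℝ) / q : ℝ) : ℂ) := by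
    push_cast; ring
  rw [h, Complex.norm_real, Real.norm_eq_abs, abs_of_nonneg (by positivity)]
  have : (0 : ℝ) ≤ (coupledNu m M q : ℝ) / q := by positivity
  linarith

omit [Fintype ι] in
/-- `1 + ν_p/p ≠ 0`. [cite: Maynard2016LargeGaps, §6 display (6.13)] -/
theorem one_add_coupledNu_div_ne_zero (m : ℕ) (M : ℕ → Finset (ι × κ)) (q : ℕ) :
    (1 : ℂ) + (coupledNu m M q : ℂ) / q ≠ 0 := by
  intro h
  have := one_le_norm_one_add_coupledNu_div m M q
  rw [h, norm_zero] at this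
  exact absurd this (by norm_num)

/-- The normalising product `B_p B'_p (1 + ν_p/p)` has norm `≥ 6^{−k−k'}`. [cite: Polymath8b2014, Lemma 4.1 (proof, (kp-est))] -/
theorem norm_zetaFactor_mul_ge {m : ℕ} {M : ℕ → Finset (ι × κ)} {a b : ι → ℂ} {a' b' : κ → ℂ}
    (hab : ∀ i, 0 ≤ (a i).re ∧ 0 ≤ (b i).re) (hab' : ∀ j, 0 ≤ (a' j).re ∧ 0 ≤ (b' j).re)
    {q : ℕ} (hq : 2 ≤ q) :
    (1 / 6 : ℝ) ^ (Fintype.card ι + Fintype.card κ) ≤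
      ‖zetaFactor a b q * zetaFactor a' b' q * (1 + (coupledNu m M q : ℂ) / q)‖ := by
  rw [norm_mul, norm_mul, pow_add]
  calc (1 / 6 : ℝ) ^ Fintype.card ι * (1 / 6 : ℝ) ^ Fintype.card κ
      = (1 / 6 : ℝ) ^ Fintype.card ι * (1 / 6 : ℝ) ^ Fintype.card κ * 1 := (mul_one _).symm
    _ ≤ _ := mul_le_mul (mul_le_mul (norm_zetaFactor_ge hab hq) (norm_zetaFactor_ge hab' hq)
        (by positivity) (norm_nonneg _)) (one_le_norm_one_add_coupledNu_div m M q)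
        (by positivity) (by positivity)

/-- **`K_p = (1 + η_p) · B_p(s,s') B_p(r,r') · (1 + ν_p/p)`** (all exponents of real part `≥ 0`, `p ≥ 2`).
[cite: Maynard2016LargeGaps, §6 display (6.13)] -/
theorem coupledLocalFactorMu_eq_mul {m : ℕ} {M : ℕ → Finset (ι × κ)} {a b : ι → ℂ} {a' b' : κ → ℂ}
    (hab : ∀ i, 0 ≤ (a i).re ∧ 0 ≤ (b i).re) (hab' : ∀ j, 0 ≤ (a' j).re ∧ 0 ≤ (b' j).re)
    {q : ℕ} (hq : 2 ≤ q) :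
    coupledLocalFactorMu m M a b a' b' q =
      (1 + coupledEps m M a b a' b' q) *
        (zetaFactor a b q * zetaFactor a' b' q * (1 + (coupledNu m M q : ℂ) / q)) := by
  have hne : zetaFactor a b q * zetaFactor a' b' q * (1 + (coupledNu m M q : ℂ) / q) ≠ 0 :=
    mul_ne_zero (mul_ne_zero (zetaFactor_ne_zero hab hq) (zetaFactor_ne_zero hab' hq))
      (one_add_coupledNu_div_ne_zero m M q)
  unfold coupledEps
  rw [add_sub_cancel, div_mul_cancel₀ _ hne]

/-- `η_p = (K_p − P_p)/P_p`. [folklore] -/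
private theorem coupledEps_eq {m : ℕ} {M : ℕ → Finset (ι × κ)} {a b : ι → ℂ} {a' b' : κ → ℂ}
    (hab : ∀ i, 0 ≤ (a i).re ∧ 0 ≤ (b i).re) (hab' : ∀ j, 0 ≤ (a' j).re ∧ 0 ≤ (b' j).re)
    {q : ℕ} (hq : 2 ≤ q) :
    coupledEps m M a b a' b' q =
      (coupledLocalFactorMu m M a b a' b' q -
          zetaFactor a b q * zetaFactor a' b' q * (1 + (coupledNu m M q : ℂ) / q)) /
        (zetaFactor a b q * zetaFactor a' b' q * (1 + (coupledNu m M q : ℂ) / q)) := by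
  have hne : zetaFactor a b q * zetaFactor a' b' q * (1 + (coupledNu m M q : ℂ) / q) ≠ 0 :=
    mul_ne_zero (mul_ne_zero (zetaFactor_ne_zero hab hq) (zetaFactor_ne_zero hab' hq))
      (one_add_coupledNu_div_ne_zero m M q)
  unfold coupledEps
  rw [sub_div, div_self hne]

/-- **(6.13) in relative form**: `‖η_p‖ ≤ 6^{k+k'} (C₂(k,k')/p² + 16(k'+kk') τ log p / p)` at every prime
`p ≥ 7k, 7k'`. [cite: Maynard2016LargeGaps, §6 display (6.13)] -/
theorem norm_coupledEps_le {m : ℕ} {M : ℕ → Finset (ι × κ)} {a b : ι → ℂ}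
    {a' b' : κ → ℂ} (hab : ∀ i, 0 ≤ (a i).re ∧ 0 ≤ (b i).re)
    (hab' : ∀ j, 0 ≤ (a' j).re ∧ 0 ≤ (b' j).re) {q : ℕ} (hq : q.Prime)
    (hqk : 7 * Fintype.card ι ≤ q) (hqk' : 7 * Fintype.card κ ≤ q) {τ : ℝ} (hτ0 : 0 ≤ τ)
    (ha : ∀ i, ‖a i‖ ≤ τ) (ha' : ∀ j, ‖a' j‖ ≤ τ) :
    ‖coupledEps m M a b a' b' q‖ ≤
      6 ^ (Fintype.card ι + Fintype.card κ) *
        (badConst (Fintype.card ι) (Fintype.card κ) / (q : ℝ) ^ 2 +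
          16 * (Fintype.card κ + Fintype.card ι * Fintype.card κ) * (τ * Real.log q) / q) := by
  have hq2 := hq.two_le
  have hP := norm_zetaFactor_mul_ge (m := m) (M := M) hab hab' hq2
  have hP0 : (0 : ℝ) < (1 / 6 : ℝ) ^ (Fintype.card ι + Fintype.card κ) := by positivity
  have hnum := norm_coupledLocalFactorMu_sub_le (m := m) (M := M) hab hab' hq hqk hqk' hτ0 ha ha'
  rw [coupledEps_eq hab hab' hq2, norm_div, div_le_iff₀ (hP0.trans_le hP)]
  set P := zetaFactor a b q * zetaFactor a' b' q * (1 + (coupledNu m M q : ℂ) / q)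
  set X := badConst (Fintype.card ι) (Fintype.card κ) / (q : ℝ) ^ 2 +
    16 * (Fintype.card κ + Fintype.card ι * Fintype.card κ) * (τ * Real.log q) / q
  have h6 : (6 : ℝ) ^ (Fintype.card ι + Fintype.card κ) *
      (1 / 6 : ℝ) ^ (Fintype.card ι + Fintype.card κ) = 1 := by
    rw [← mul_pow]; norm_num
  have h1 : 1 ≤ (6 : ℝ) ^ (Fintype.card ι + Fintype.card κ) * ‖P‖ :=
    h6.symm.le.trans (mul_le_mul_of_nonneg_left hP (by positivity))
  have hB : 0 ≤ X := by
    have := badConst_nonneg (Fintype.card ι) (Fintype.card κ)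
    have : 0 ≤ τ * Real.log q :=
      mul_nonneg hτ0 (Real.log_nonneg (by exact_mod_cast hq.one_lt.le))
    positivity
  calc ‖coupledLocalFactorMu m M a b a' b' q - P‖ ≤ X := hnum
    _ = X * 1 := (mul_one _).symm
    _ ≤ X * ((6 : ℝ) ^ (Fintype.card ι + Fintype.card κ) * ‖P‖) := mul_le_mul_of_nonneg_left h1 hB
    _ = _ := by ring

/-- **(6.12) in relative form**: at a good prime `‖η_p‖ ≤ 6^{k+k'} C₁(k,k')/p²` — no dependence on the
exponents beyond `Re ≥ 0`. [cite: Maynard2016LargeGaps, §6 display (6.12)] -/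
theorem norm_coupledEps_le_of_good {m : ℕ} {M : ℕ → Finset (ι × κ)} {a b : ι → ℂ}
    {a' b' : κ → ℂ} (hab : ∀ i, 0 ≤ (a i).re ∧ 0 ≤ (b i).re)
    (hab' : ∀ j, 0 ≤ (a' j).re ∧ 0 ≤ (b' j).re) {q : ℕ} (hq : q.Prime)
    (hqk : 7 * Fintype.card ι ≤ q) (hqk' : 7 * Fintype.card κ ≤ q) (hqm : ¬ q ∣ m) (hM : M q = ∅) :
    ‖coupledEps m M a b a' b' q‖ ≤
      6 ^ (Fintype.card ι + Fintype.card κ) *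
        (goodConst (Fintype.card ι) (Fintype.card κ) / (q : ℝ) ^ 2) := by
  have hq2 := hq.two_le
  have hP := norm_zetaFactor_mul_ge (m := m) (M := M) hab hab' hq2
  have hP0 : (0 : ℝ) < (1 / 6 : ℝ) ^ (Fintype.card ι + Fintype.card κ) := by positivity
  have hν : (coupledNu m M q : ℂ) = 0 := by simp [coupledNu, hqm, hM]
  have hnum := norm_coupledLocalFactorMu_sub_zetaFactor_mul_le_of_good (m := m) hab hab' hq hqk hqk' hqm hM
  rw [coupledEps_eq hab hab' hq2, norm_div, div_le_iff₀ (hP0.trans_le hP)]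
  rw [hν, zero_div, add_zero, mul_one] at hP ⊢
  set P := zetaFactor a b q * zetaFactor a' b' q
  set X := goodConst (Fintype.card ι) (Fintype.card κ) / (q : ℝ) ^ 2
  have h6 : (6 : ℝ) ^ (Fintype.card ι + Fintype.card κ) *
      (1 / 6 : ℝ) ^ (Fintype.card ι + Fintype.card κ) = 1 := by
    rw [← mul_pow]; norm_num
  have h1 : 1 ≤ (6 : ℝ) ^ (Fintype.card ι + Fintype.card κ) * ‖P‖ :=
    h6.symm.le.trans (mul_le_mul_of_nonneg_left hP (by positivity))
  have hB : 0 ≤ X := by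
    have := goodConst_nonneg (Fintype.card ι) (Fintype.card κ)
    positivity
  calc ‖coupledLocalFactorMu m M a b a' b' q - P‖ ≤ X := hnum
    _ = X * 1 := (mul_one _).symm
    _ ≤ X * ((6 : ℝ) ^ (Fintype.card ι + Fintype.card κ) * ‖P‖) := mul_le_mul_of_nonneg_left h1 hB
    _ = _ := by ring

end LcmEuler

end Literature.NumberTheory.Sieve

end
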